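import Summits.ValiantsHypothesis.ValiantsHypothesis.Theorems.SymPencilPerFourPeeledCornerGenSwapAll
import Summits.ValiantsHypothesis.ValiantsHypothesis.Theorems.SymPencilPerFourPeeledCornerGenSwapCertificate
import Summits.ValiantsHypothesis.ValiantsHypothesis.Theorems.SymPencilPerFourPeeledTwoPencilCoreClasses
import Summits.ValiantsHypothesis.ValiantsHypothesis.Theorems.SymPencilPerFourPeeledTwoPencilClassify

/-!
# Route `SymPencil` — `2 | 2` inner rank of `per_4`, PEELED case at `≤ 11` squares: the corner
# ENTRY POINT for the coverage theorem — two frameless generalized swaps are impossible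
# (`--supports` stmt-ValiantsHypothesis-5674 `SdcSuperquadratic`; (8,8) column, cell (8,8,11);
# memos `NOTE-p6g16-5674-corner-double-swap.md`, `NOTE-p8g15-5674-R2-two-pencil.md` §9.6–§9.7)

**Theorem** (`false_of_frameless_genswap_pair`).  Let `t` be a reduced peeled family on `≤ 11`
squares with non-zero weights, whose two scalar blocks are represented by matrices `Ψ, Ψ′`
(`t(a,0)(x,0) = (aᵀΨx)·v₀`, `t(0,b)(0,x) = (bᵀΨ′x)·v₀′`) that are both FRAMELESS (no two-pencil
frame in the sense of `…TwoPencilDesign.false_of_frame`) and both GENERALIZED SWAPS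
(`aᵀΨx = u₀a_ix_j + w₀a_jx_i`, `bᵀΨ′x = u₁b_kx_l + w₁b_lx_k`, `i ≠ j`, `k ≠ l`, non-zero
coefficients).  Then `False`.  Assembly of the corner side:
* different pairs, or the same pair off the locus: `…CornerGenSwapAll.false_of_double_genswap`;
* the same pair ON the locus `u₀u₁ + w₀w₁ = 0` (consistent presentation): the ratios
  `r₀ = −u₀/w₀`, `r₁ = −u₁/w₁` satisfy `r₀r₁ = −1`, so by the certificate
  `…CornerGenSwapCertificate.offLocus_of_exceptional` one of them passes all nine side conditions
  of `…TwoPencilCoreClasses.frames_of_generalized_swap` (val-lit-p8 g15), which then FRAMES that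
  matrix (after `…TwoPencilClassify.frames_of_submatrix` along a permutation `σ` with
  `σ0 = i, σ1 = j`) — contradicting framelessness.
With `…TwoPencilFramelessFlip.exists_frameless_quadruple_of_peeled` (p8 g15) and the coverage
theorem "frameless `Ψ`, `Ψᵀ` ⇒ `Ψ` is a generalized swap" (p8 g16, in progress) this closes the
peeled case at eleven squares, i.e. cell (8,8,11).

Honest framing: corner-side entry point only; the coverage theorem is NOT in the tree yet, so
(8,8,11) stays OPEN; `28 ≤ sdc(per_4) ≤ 29` of record, the crux `SdcSuperquadratic` and
`VP ≠ VNP` untouched.  No definitions, no named facts. [folklore]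
-/

noncomputable section

-- single-conjunct layout: Sub = Summit, duplicated namespace component intended
set_option linter.dupNamespace false

namespace Summit.ValiantsHypothesis.ValiantsHypothesis.Theorems.SymPencilPerFourPeeledCornerGenSwapFrameless

open Matrix Finset Module
open Summit.ValiantsHypothesis.ValiantsHypothesis.Theorems.SymPencilPerFourPeeledCornerGenSwapAll
open Summit.ValiantsHypothesis.ValiantsHypothesis.Theorems.SymPencilPerFourPeeledCornerGenSwapCertificate
open Summit.ValiantsHypothesis.ValiantsHypothesis.Theorems.SymPencilPerFourPeeledCornerSwapAll
open Summit.ValiantsHypothesis.ValiantsHypothesis.Theorems.SymPencilPerFourPeeledTwoPencilCoreClasses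
open Summit.ValiantsHypothesis.ValiantsHypothesis.Theorems.SymPencilPerFourPeeledTwoPencilClassify

universe u v

variable {K : Type u} [Field K]

/-- Entries of a matrix whose bilinear form is a generalized swap. [folklore] -/
theorem entry_of_genswap_form (Ψ : Matrix (Fin 4) (Fin 4) K) (i j : Fin 4) (u w : K)
    (hf : ∀ a x : Fin 4 → K, a ⬝ᵥ Ψ *ᵥ x = u * a i * x j + w * a j * x i) (p q : Fin 4) :
    Ψ p q = u * (if i = p ∧ j = q then 1 else 0) + w * (if j = p ∧ i = q then 1 else 0) := by
  classical
  have h := hf (Pi.single p 1) (Pi.single q 1)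
  rw [Matrix.mulVec_single_one, single_one_dotProduct] at h
  rw [show Ψ p q = Ψ.col q p from rfl, h]
  simp only [Pi.single_apply]
  split_ifs <;> simp_all

/-- The normal form along a permutation: if `aᵀΨx = u a_i x_j + w a_j x_i` and `σ0 = i`, `σ1 = j`,
then `Ψ.submatrix σ σ = uE₀₁ + wE₁₀`. [folklore] -/
theorem submatrix_eq_of_genswap_form (Ψ : Matrix (Fin 4) (Fin 4) K) (i j : Fin 4) (hij : i ≠ j)
    (u w : K) (hf : ∀ a x : Fin 4 → K, a ⬝ᵥ Ψ *ᵥ x = u * a i * x j + w * a j * x i)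
    (σ : Equiv.Perm (Fin 4)) (h0 : σ 0 = i) (h1 : σ 1 = j) :
    Ψ.submatrix σ σ = !![0, u, 0, 0; w, 0, 0, 0; 0, 0, 0, 0; 0, 0, 0, 0] := by
  have h2i : i ≠ σ 2 := fun h => absurd (σ.injective (h0.trans h)) (by decide)
  have h2j : j ≠ σ 2 := fun h => absurd (σ.injective (h1.trans h)) (by decide)
  have h3i : i ≠ σ 3 := fun h => absurd (σ.injective (h0.trans h)) (by decide)
  have h3j : j ≠ σ 3 := fun h => absurd (σ.injective (h1.trans h)) (by decide)
  ext p q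
  fin_cases p <;> fin_cases q <;>
    simp [Matrix.submatrix_apply, entry_of_genswap_form Ψ i j u w hf, h0, h1, hij, hij.symm, h2i,
      h2j, h3i, h3j]

/-- ★★ **Two frameless generalized swaps are impossible.**  See the module docstring. [folklore] -/
theorem false_of_frameless_genswap_pair [CharZero K] {κ : Type v} [Fintype κ] [DecidableEq κ]
    (hκ : Fintype.card κ ≤ 11) (c : κ → K) (hc : ∀ r, c r ≠ 0)
    (t : κ → (((Fin 4 → K) × (Fin 4 → K)) →ₗ[K] ((Fin 4 → K) × (Fin 4 → K)) →ₗ[K] K))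
    (hJ : ∀ a b y₂ y₃ : Fin 4 → K,
      ∑ r, c r * (t r (a, b) (y₂, y₃)) ^ 2 = (Matrix.of ![a, b, y₂, y₃]).permanent)
    (v₀ v₀' : κ → K) (hv₀ : ∀ (a x : Fin 4 → K), ∃ s : K, (fun r => t r (a, 0) (x, 0)) = s • v₀)
    (hv₀' : ∀ (b x : Fin 4 → K), ∃ s : K, (fun r => t r (0, b) (0, x)) = s • v₀')
    (hpeel : ∃ a b y z : Fin 4 → K, ∑ r, c r * t r (a, 0) (y, 0) * t r (0, b) (0, z) ≠ 0)
    (Ψ Ψ' : Matrix (Fin 4) (Fin 4) K)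
    (hΨ : ∀ (a x : Fin 4 → K) (r : κ), t r (a, 0) (x, 0) = (a ⬝ᵥ Ψ *ᵥ x) * v₀ r)
    (hΨ' : ∀ (b x : Fin 4 → K) (r : κ), t r (0, b) (0, x) = (b ⬝ᵥ Ψ' *ᵥ x) * v₀' r)
    (hn : ¬ ∃ (a₀ a₁ y₀ y₁ : Fin 4 → K) (P₀₀ P₁₀ P₀₁ P₁₁ W₀ : Matrix (Fin 4) (Fin 4) K)
        (v : Fin 4 → Fin 4 → K) (s : Fin 4 → K) (W : Matrix (Fin 4) (Fin 4) K),
        a₀ ⬝ᵥ Ψ *ᵥ y₀ = 0 ∧ a₀ ⬝ᵥ Ψ *ᵥ y₁ = 0 ∧ a₁ ⬝ᵥ Ψ *ᵥ y₀ = 0 ∧ a₁ ⬝ᵥ Ψ *ᵥ y₁ = 0 ∧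
        (∀ b l, P₀₀ b l = (Matrix.of ![a₀, Pi.single b 1, y₀, Pi.single l 1]).permanent) ∧
        (∀ b l, P₁₀ b l = (Matrix.of ![a₀, Pi.single b 1, y₁, Pi.single l 1]).permanent) ∧
        (∀ b l, P₀₁ b l = (Matrix.of ![a₁, Pi.single b 1, y₀, Pi.single l 1]).permanent) ∧
        (∀ b l, P₁₁ b l = (Matrix.of ![a₁, Pi.single b 1, y₁, Pi.single l 1]).permanent) ∧
        W₀ * P₀₀ = 1 ∧ (∀ j, P₁₀ *ᵥ v j = s j • P₀₀ *ᵥ v j) ∧ (∀ i j, i ≠ j → s i ≠ s j) ∧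
        W * Matrix.of v = 1 ∧ P₁₁ - P₁₀ * W₀ * P₀₁ ≠ 0)
    (hn' : ¬ ∃ (a₀ a₁ y₀ y₁ : Fin 4 → K) (P₀₀ P₁₀ P₀₁ P₁₁ W₀ : Matrix (Fin 4) (Fin 4) K)
        (v : Fin 4 → Fin 4 → K) (s : Fin 4 → K) (W : Matrix (Fin 4) (Fin 4) K),
        a₀ ⬝ᵥ Ψ' *ᵥ y₀ = 0 ∧ a₀ ⬝ᵥ Ψ' *ᵥ y₁ = 0 ∧ a₁ ⬝ᵥ Ψ' *ᵥ y₀ = 0 ∧ a₁ ⬝ᵥ Ψ' *ᵥ y₁ = 0 ∧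
        (∀ b l, P₀₀ b l = (Matrix.of ![a₀, Pi.single b 1, y₀, Pi.single l 1]).permanent) ∧
        (∀ b l, P₁₀ b l = (Matrix.of ![a₀, Pi.single b 1, y₁, Pi.single l 1]).permanent) ∧
        (∀ b l, P₀₁ b l = (Matrix.of ![a₁, Pi.single b 1, y₀, Pi.single l 1]).permanent) ∧
        (∀ b l, P₁₁ b l = (Matrix.of ![a₁, Pi.single b 1, y₁, Pi.single l 1]).permanent) ∧
        W₀ * P₀₀ = 1 ∧ (∀ j, P₁₀ *ᵥ v j = s j • P₀₀ *ᵥ v j) ∧ (∀ i j, i ≠ j → s i ≠ s j) ∧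
        W * Matrix.of v = 1 ∧ P₁₁ - P₁₀ * W₀ * P₀₁ ≠ 0)
    (i j : Fin 4) (hij : i ≠ j) (u₀ w₀ : K) (hu₀ : u₀ ≠ 0) (hw₀ : w₀ ≠ 0)
    (hf : ∀ a x : Fin 4 → K, a ⬝ᵥ Ψ *ᵥ x = u₀ * a i * x j + w₀ * a j * x i)
    (k l : Fin 4) (hkl : k ≠ l) (u₁ w₁ : K) (hu₁ : u₁ ≠ 0) (hw₁ : w₁ ≠ 0)
    (hf' : ∀ b x : Fin 4 → K, b ⬝ᵥ Ψ' *ᵥ x = u₁ * b k * x l + w₁ * b l * x k) : False := by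
  classical
  have hψ : ∀ (a x : Fin 4 → K) r, t r (a, 0) (x, 0) = (u₀ * a i * x j + w₀ * a j * x i) * v₀ r :=
    fun a x r => by rw [hΨ, hf]
  -- a permutation normalising the first pair
  obtain ⟨π, hπi, hπj⟩ := exists_perm_01 i j hij
  have hσ0 : π.symm 0 = i := by rw [← hπi, Equiv.symm_apply_apply]
  have hσ1 : π.symm 1 = j := by rw [← hπj, Equiv.symm_apply_apply]
  -- a frame for a generalized swap on (i,j) whose ratio passes the nine side conditions
  have frame_of_good : ∀ (Φ : Matrix (Fin 4) (Fin 4) K) (u w : K), u ≠ 0 → w ≠ 0 →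
      (∀ a x : Fin 4 → K, a ⬝ᵥ Φ *ᵥ x = u * a i * x j + w * a j * x i) →
      ¬ ((-u / w) + 1 = 0 ∨ 3 * (-u / w) + 4 = 0 ∨
          (-u / w) ^ 3 - 8 * (-u / w) ^ 2 - 20 * (-u / w) - 12 = 0 ∨
          (-u / w) ^ 2 + 4 * (-u / w) + 1 = 0 ∨ 4 * (-u / w) ^ 2 + 7 * (-u / w) + 4 = 0 ∨
          (-u / w) ^ 2 + (-u / w) + 1 = 0 ∨
          (-u / w) ^ 4 - 7 * (-u / w) ^ 3 - 15 * (-u / w) ^ 2 - 7 * (-u / w) + 1 = 0 ∨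
          (-u / w) - 3 = 0 ∨ (-u / w) ^ 2 - 3 = 0) →
      ∃ (a₀ a₁ y₀ y₁ : Fin 4 → K) (P₀₀ P₁₀ P₀₁ P₁₁ W₀ : Matrix (Fin 4) (Fin 4) K)
        (v : Fin 4 → Fin 4 → K) (s : Fin 4 → K) (W : Matrix (Fin 4) (Fin 4) K),
        a₀ ⬝ᵥ Φ *ᵥ y₀ = 0 ∧ a₀ ⬝ᵥ Φ *ᵥ y₁ = 0 ∧ a₁ ⬝ᵥ Φ *ᵥ y₀ = 0 ∧ a₁ ⬝ᵥ Φ *ᵥ y₁ = 0 ∧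
        (∀ b l, P₀₀ b l = (Matrix.of ![a₀, Pi.single b 1, y₀, Pi.single l 1]).permanent) ∧
        (∀ b l, P₁₀ b l = (Matrix.of ![a₀, Pi.single b 1, y₁, Pi.single l 1]).permanent) ∧
        (∀ b l, P₀₁ b l = (Matrix.of ![a₁, Pi.single b 1, y₀, Pi.single l 1]).permanent) ∧
        (∀ b l, P₁₁ b l = (Matrix.of ![a₁, Pi.single b 1, y₁, Pi.single l 1]).permanent) ∧
        W₀ * P₀₀ = 1 ∧ (∀ j, P₁₀ *ᵥ v j = s j • P₀₀ *ᵥ v j) ∧ (∀ i j, i ≠ j → s i ≠ s j) ∧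
        W * Matrix.of v = 1 ∧ P₁₁ - P₁₀ * W₀ * P₀₁ ≠ 0 := by
    intro Φ u w hu hw hfΦ hgood
    push Not at hgood
    obtain ⟨g1, g34, gcub, gq1, gq2, gq3, gquart, g3, gsq3⟩ := hgood
    refine frames_of_submatrix π.symm Φ (frames_of_generalized_swap (Φ.submatrix π.symm π.symm)
      w u (-u / w) (by field_simp) (div_ne_zero (neg_ne_zero.2 hu) hw) g1 g34 gcub gq1 gq2 gq3
      gquart g3 gsq3 (submatrix_eq_of_genswap_form Φ i j hij u w hfΦ π.symm hσ0 hσ1))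
  -- the consistent same-pair case, for arbitrary non-zero coefficients of the second block
  have same : ∀ (U W : K), U ≠ 0 → W ≠ 0 →
      (∀ b x : Fin 4 → K, b ⬝ᵥ Ψ' *ᵥ x = U * b i * x j + W * b j * x i) → False := by
    intro U W hU hW hfU
    have hψU : ∀ (b x : Fin 4 → K) r,
        t r (0, b) (0, x) = (U * b i * x j + W * b j * x i) * v₀' r :=
      fun b x r => by rw [hΨ', hfU]
    by_cases hloc : u₀ * U + w₀ * W = 0
    · -- on the locus: one of the two ratios is good, and that matrix is framed
      have hrr : (-u₀ / w₀) * (-U / W) + 1 = 0 := by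
        field_simp
        linear_combination hloc
      by_cases h0 : (-u₀ / w₀) + 1 = 0 ∨ 3 * (-u₀ / w₀) + 4 = 0 ∨
          (-u₀ / w₀) ^ 3 - 8 * (-u₀ / w₀) ^ 2 - 20 * (-u₀ / w₀) - 12 = 0 ∨
          (-u₀ / w₀) ^ 2 + 4 * (-u₀ / w₀) + 1 = 0 ∨ 4 * (-u₀ / w₀) ^ 2 + 7 * (-u₀ / w₀) + 4 = 0 ∨
          (-u₀ / w₀) ^ 2 + (-u₀ / w₀) + 1 = 0 ∨
          (-u₀ / w₀) ^ 4 - 7 * (-u₀ / w₀) ^ 3 - 15 * (-u₀ / w₀) ^ 2 - 7 * (-u₀ / w₀) + 1 = 0 ∨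
          (-u₀ / w₀) - 3 = 0 ∨ (-u₀ / w₀) ^ 2 - 3 = 0
      · by_cases h1 : (-U / W) + 1 = 0 ∨ 3 * (-U / W) + 4 = 0 ∨
            (-U / W) ^ 3 - 8 * (-U / W) ^ 2 - 20 * (-U / W) - 12 = 0 ∨
            (-U / W) ^ 2 + 4 * (-U / W) + 1 = 0 ∨ 4 * (-U / W) ^ 2 + 7 * (-U / W) + 4 = 0 ∨
            (-U / W) ^ 2 + (-U / W) + 1 = 0 ∨
            (-U / W) ^ 4 - 7 * (-U / W) ^ 3 - 15 * (-U / W) ^ 2 - 7 * (-U / W) + 1 = 0 ∨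
            (-U / W) - 3 = 0 ∨ (-U / W) ^ 2 - 3 = 0
        · exact offLocus_of_exceptional _ _ h0 h1 hrr
        · exact hn' (frame_of_good Ψ' U W hU hW hfU h1)
      · exact hn (frame_of_good Ψ u₀ w₀ hu₀ hw₀ hf h0)
    · exact false_of_double_genswap hκ c hc t hJ v₀ v₀' hv₀ hv₀' hpeel u₀ w₀ U W hu₀ hw₀ hU hW
        i j i j hij hij ⟨fun _ => hloc, fun ⟨hji, _⟩ => absurd hji hij⟩ hψ hψU
  -- dispatch on the second pair
  by_cases hs : k = i ∧ l = j
  · obtain ⟨rfl, rfl⟩ := hs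
    exact same u₁ w₁ hu₁ hw₁ hf'
  by_cases hs' : k = j ∧ l = i
  · obtain ⟨rfl, rfl⟩ := hs'
    exact same w₁ u₁ hw₁ hu₁ (fun b x => by rw [hf']; ring)
  have hψ' : ∀ (b x : Fin 4 → K) r,
      t r (0, b) (0, x) = (u₁ * b k * x l + w₁ * b l * x k) * v₀' r :=
    fun b x r => by rw [hΨ', hf']
  exact false_of_double_genswap hκ c hc t hJ v₀ v₀' hv₀ hv₀' hpeel u₀ w₀ u₁ w₁ hu₀ hw₀ hu₁ hw₁
    i j k l hij hkl ⟨fun h => (hs h).elim, fun h => (hs' h).elim⟩ hψ hψ'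

end Summit.ValiantsHypothesis.ValiantsHypothesis.Theorems.SymPencilPerFourPeeledCornerGenSwapFrameless

end
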